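import Summits.SmoothPoincare4.SmoothPoincare4.Theorems.ConvexBisectionAcyclicBisectionExistsHurwitzReduction
import Mathlib.Analysis.SpecialFunctions.Trigonometric.Bounds
import HarnessLib

/-!
# N1 ▸ `node_N1_move` ▸ (d) N1-mono (the deep-belt monodromy model), brick H4-1′:
# OFF THE BELT PAGE ANGLE THE PAGES OF `∂X` ARE BASE PAGES (the backbone of the COVER clause)
(wave 7, crux stmt-SmoothPoincare4-10508, line `modp-braid-orbits`, registered stub `stub_M2geo` (N1) ▸
`node_N1_move` ▸ sub-node (d); registered sub-goal `helper_offCritical_seam`)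

The telescope of `node_N1_move`: the original piece `X₀` with boundary datum `bX` and the page-certifying
`Ψ : ∂X₀ ≅ ∂ Base g`, the current piece `X` with `G₀ : X₀ ≅ X`, attaching maps `h : Fin n → T → Base g` with
data `D` of `X`, unit directions `d j`; the SEAM clause (`G₀ (bX.incl y) = D.jA a ⇒ w (Ψ y) ∈ ℝ_{>0} w a`) and
the BELT clause (`G₀ (bX.incl y) = D.jB j b ∉ range D.jA ⇒ w (Ψ y) ∈ ℝ_{>0} d j`) through `G₀`.  The boundary
open book of `X` read on `∂X₀` is `θ_X (y) := arg w (Ψ y)`.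

* §1 **angle gap** (`exists_angle_gap`): if no other handle shares the direction of `k`, then for
  `0 < |σ| < η` the direction `d k · e^{iσ}` is the direction of NO handle;
* §2 **boundary points through `G₀`** (`mem_boundary_of_G₀_incl_eq_jA`, `exists_carrier_of_jA`): a seam
  point `G₀ (bX.incl y) = D.jA a` has `a ∈ ∂ Base g`, and conversely every `a ∈ ∂ Base g` off the cores
  is `G₀ (bX.incl y)` for a unique `y ∈ ∂X₀`;
* §3 **off-critical pages are seam** (`seam_of_offCritical`, registered `helper_offCritical_seam`): if
  `θ_X (y) = θ_k + σ` with `d k · e^{iσ}` the direction of no handle (e.g. `0 < |σ| < η`), then `y` is a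
  seam point `G₀⁻¹ (D.jA a)` with `arg w a = θ_k + σ`, `a ∈ ∂ Base g`: the `∂X`-page of a non-critical
  angle, read on the base through the seam, is EXACTLY the (extended) base page of that angle off the cores
  — the two one-sided regions of the fibred belt chart of (d) (`work/stubs/H4H7_interface.lean`, clauses
  BELOW/ABOVE/COVER) live here.

Everything is proved; no named facts, no `sorry`.  References: A. A. Kosinski, *Differential Manifolds*
(1993), VI §6 [Kosinski1993]; J. B. Etnyre, T. Fuller, IMRN 2006, Thm. 1 (proof, p. 8) [EtnyreFuller2006].
-/

noncomputable section

set_option linter.dupNamespace false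

open scoped Manifold ContDiff Topology
open Set Function Metric Complex
open Literature.Topology.FourManifolds Literature.Topology.FourManifolds.HandleAttachingMap
  Literature.Topology.FourManifolds.LefschetzBase

namespace Summit.SmoothPoincare4.SmoothPoincare4.Theorems.AcyclicBisectionExists.ModpBraidOrbits

/-! ## §1 The angle gap around the direction of one handle -/

/-- `‖e^{iσ} − 1‖ ≤ |σ|`. [folklore] -/
theorem norm_exp_ofReal_mul_I_sub_one_le (σ : ℝ) :
    ‖Complex.exp ((σ : ℂ) * Complex.I) - 1‖ ≤ |σ| := by
  have h := Real.norm_exp_I_mul_ofReal_sub_one_le (x := σ)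
  rw [mul_comm] at h
  rwa [Real.norm_eq_abs] at h

/-- A unit direction rotated by a small non-zero angle is a different direction:
`0 < |σ| < 2π ⇒ e^{iσ} ≠ 1`. [folklore] -/
theorem exp_ofReal_mul_I_ne_one {σ : ℝ} (hσ0 : σ ≠ 0) (hσ : |σ| < 2 * Real.pi) :
    Complex.exp ((σ : ℂ) * Complex.I) ≠ 1 := by
  intro h1
  rw [Complex.exp_eq_one_iff] at h1
  obtain ⟨m, hm⟩ := h1
  have hσm : σ = (m : ℝ) * (2 * Real.pi) := by
    have := congrArg Complex.im hm
    simpa using this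
  have hlt := abs_lt.1 hσ
  have h1 : (m : ℝ) * (2 * Real.pi) < 1 * (2 * Real.pi) := by rw [← hσm]; linarith
  have h2 : (-1) * (2 * Real.pi) < (m : ℝ) * (2 * Real.pi) := by rw [← hσm]; linarith
  have h3 : (m : ℝ) < 1 := lt_of_mul_lt_mul_right h1 (by positivity)
  have h4 : (-1 : ℝ) < m := lt_of_mul_lt_mul_right h2 (by positivity)
  have h5 : m = 0 := by
    have h3' : (m : ℤ) < 1 := by exact_mod_cast h3
    have h4' : (-1 : ℤ) < m := by exact_mod_cast h4
    omega
  rw [h5, Int.cast_zero, zero_mul] at hσm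
  exact hσ0 hσm

/-- **The angle gap**: for unit directions `d j` with `d j ≠ d k` (`j ≠ k`) there is `η ∈ (0, π]` such that
`d k · e^{iσ}` is the direction of NO handle whenever `0 < |σ| < η`. [folklore] -/
theorem exists_angle_gap {n : ℕ} (d : Fin n → ℂ) (k : Fin n) (hd : ∀ j, ‖d j‖ = 1)
    (hdk : ∀ j, j ≠ k → d j ≠ d k) :
    ∃ η : ℝ, 0 < η ∧ η ≤ Real.pi ∧ ∀ σ : ℝ, σ ≠ 0 → |σ| < η →
      ∀ j, d j ≠ d k * Complex.exp ((σ : ℂ) * Complex.I) := by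
  classical
  -- the gaps `‖d j − d k‖`, `j ≠ k`, are positive; take `η` below all of them and below `π`
  let S : Finset ℝ := (Finset.univ.filter fun j : Fin n => j ≠ k).image fun j => ‖d j - d k‖
  have hSpos : ∀ x ∈ S, 0 < x := by
    intro x hx
    obtain ⟨j, hj, rfl⟩ := Finset.mem_image.1 hx
    exact norm_pos_iff.2 (sub_ne_zero.2 (hdk j (Finset.mem_filter.1 hj).2))
  obtain ⟨η, hη, hηπ, hηS⟩ : ∃ η : ℝ, 0 < η ∧ η ≤ Real.pi ∧ ∀ x ∈ S, η ≤ x := by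
    by_cases hS : S.Nonempty
    · refine ⟨min Real.pi (S.min' hS), lt_min Real.pi_pos (hSpos _ (S.min'_mem hS)), min_le_left _ _,
        fun x hx => (min_le_right _ _).trans (S.min'_le x hx)⟩
    · refine ⟨Real.pi, Real.pi_pos, le_rfl, fun x hx => (hS ⟨x, hx⟩).elim⟩
  refine ⟨η, hη, hηπ, fun σ hσ0 hση j hj => ?_⟩
  by_cases hjk : j = k
  · subst hjk
    have h1 : Complex.exp ((σ : ℂ) * Complex.I) = 1 := by
      have hne : d j ≠ 0 := norm_ne_zero_iff.1 (by rw [hd j]; norm_num)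
      have := hj
      nth_rw 1 [← mul_one (d j)] at this
      exact (mul_left_cancel₀ hne this).symm
    exact exp_ofReal_mul_I_ne_one hσ0 (hση.trans_le (hηπ.trans (by linarith [Real.pi_pos]))) h1
  · have hmem : ‖d j - d k‖ ∈ S :=
      Finset.mem_image.2 ⟨j, Finset.mem_filter.2 ⟨Finset.mem_univ _, hjk⟩, rfl⟩
    have hle := hηS _ hmem
    have heq : ‖d j - d k‖ = ‖Complex.exp ((σ : ℂ) * Complex.I) - 1‖ := by
      rw [hj, ← mul_sub_one, norm_mul, hd k, one_mul]
    have := norm_exp_ofReal_mul_I_sub_one_le σ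
    linarith

/-! ## §2 Boundary points through the accumulated diffeomorphism `G₀` -/

section Boundary

variable {g n : ℕ} {h : Fin n → HandleAttachingMap 3 2 (Base g)}
  {X₀ : Type} [TopologicalSpace X₀] [ChartedSpace (EuclideanHalfSpace 4) X₀]
  {X : Type} [TopologicalSpace X] [ChartedSpace (EuclideanHalfSpace 4) X]
  (bX : BoundaryData (𝓡∂ 4) X₀ (𝓡 3)) (G₀ : X₀ ≃ₘ⟮𝓡∂ 4, 𝓡∂ 4⟯ X)
  (D : MultiAttachmentData h (𝓡∂ 4) X)

/-- `G₀` maps the boundary of `X₀` into the boundary of `X`. [folklore] -/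
theorem G₀_incl_mem_boundary (y : bX.carrier) : G₀ (bX.incl y) ∈ (𝓡∂ 4).boundary X := by
  have h1 : bX.incl y ∈ (𝓡∂ 4).boundary X₀ := bX.incl_mem_boundary y
  have h2 := Diffeomorph.image_boundary (I := 𝓡∂ 4) (I' := 𝓡∂ 4) (M := X₀) (N := X) (n := ∞) (by simp) G₀
  rw [← h2]
  exact mem_image_of_mem _ h1

/-- **A seam point through `G₀` comes from a boundary point of the base**: `G₀ (bX.incl y) = D.jA a`
forces `a ∈ ∂ Base g`. [folklore] -/
theorem mem_boundary_of_G₀_incl_eq_jA {y : bX.carrier} {a : ↥(coresComplement h)}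
    (hy : G₀ (bX.incl y) = D.jA a) : (a : Base g) ∈ (𝓡∂ 4).boundary (Base g) := by
  have h1 : D.jA a ∈ (𝓡∂ 4).boundary X := hy ▸ G₀_incl_mem_boundary bX G₀ y
  have h2 : a ∈ (𝓡∂ 4).boundary ↥(coresComplement h) :=
    (mem_boundary_iff_of_isSmoothEmbedding D.hjA D.hjAo a).1 h1
  exact (mem_boundary_opens_iff (coresComplement h) a).1 h2

/-- **Every boundary point of the base off the cores is a seam point through `G₀`**: for
`a ∈ ∂ Base g` off the attaching circles there is `y ∈ ∂X₀` with `G₀ (bX.incl y) = D.jA a`. [folklore] -/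
theorem exists_carrier_of_jA {a : ↥(coresComplement h)} (ha : (a : Base g) ∈ (𝓡∂ 4).boundary (Base g)) :
    ∃ y : bX.carrier, G₀ (bX.incl y) = D.jA a := by
  have h1 : a ∈ (𝓡∂ 4).boundary ↥(coresComplement h) := (mem_boundary_opens_iff (coresComplement h) a).2 ha
  have h2 : D.jA a ∈ (𝓡∂ 4).boundary X := (mem_boundary_iff_of_isSmoothEmbedding D.hjA D.hjAo a).2 h1
  have h3 : G₀.symm (D.jA a) ∈ (𝓡∂ 4).boundary X₀ := by
    have h4 := Diffeomorph.preimage_boundary (I := 𝓡∂ 4) (I' := 𝓡∂ 4) (M := X₀) (N := X) (n := ∞)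
      (by simp) G₀
    rw [← h4, mem_preimage, Diffeomorph.apply_symm_apply]
    exact h2
  rw [← bX.range_incl] at h3
  obtain ⟨y, hy⟩ := h3
  exact ⟨y, by rw [hy, Diffeomorph.apply_symm_apply]⟩

/-- The seam point over a base point is unique. [folklore] -/
theorem carrier_unique_of_jA {y y' : bX.carrier} {a : ↥(coresComplement h)}
    (hy : G₀ (bX.incl y) = D.jA a) (hy' : G₀ (bX.incl y') = D.jA a) : y = y' :=
  bX.injective_incl (G₀.injective (hy.trans hy'.symm))

end Boundary

/-! ## §3 Off the handle directions, the pages of `∂X` are seam -/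

section OffCritical

variable {g n : ℕ} {h : Fin n → HandleAttachingMap 3 2 (Base g)}
  {X₀ : Type} [TopologicalSpace X₀] [ChartedSpace (EuclideanHalfSpace 4) X₀]
  (bX : BoundaryData (𝓡∂ 4) X₀ (𝓡 3)) (Ψ : bX.carrier → (bBase g).carrier)
  {X : Type} [TopologicalSpace X] [ChartedSpace (EuclideanHalfSpace 4) X]
  (G₀ : X₀ ≃ₘ⟮𝓡∂ 4, 𝓡∂ 4⟯ X) (D : MultiAttachmentData h (𝓡∂ 4) X) (d : Fin n → ℂ)

/-- Two positive multiples of unit vectors agree only if the unit vectors do. [folklore] -/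
theorem eq_of_pos_mul_unit_eq {c c' : ℝ} {e e' : ℂ} (hc : 0 < c) (hc' : 0 < c') (he : ‖e‖ = 1)
    (he' : ‖e'‖ = 1) (h : (c : ℂ) * e = (c' : ℂ) * e') : e = e' := by
  have hn : c = c' := by
    have := congrArg norm h
    rw [norm_mul, norm_mul, he, he', mul_one, mul_one, Complex.norm_real, Complex.norm_real,
      Real.norm_eq_abs, Real.norm_eq_abs, abs_of_pos hc, abs_of_pos hc'] at this
    exact this
  subst hn
  exact mul_left_cancel₀ (by exact_mod_cast hc.ne') h

/-- **Off the handle directions, a boundary point of `X` is a seam point** (brick H4-1′).  Under the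
belt clause through `G₀`: if `w (Ψ y)` is a positive multiple of a unit `e` which is the direction of
NO handle, then `G₀ (bX.incl y) = D.jA a` for some `a` off the cores; under the seam clause moreover
`w a ∈ ℝ_{>0} · e` and `a ∈ ∂ Base g`. [cite: Kosinski1993, VI §6] -/
theorem seam_of_offCritical
    (hseam : ∀ (y : bX.carrier) (a : ↥(coresComplement h)), G₀ (bX.incl y) = D.jA a →
      ∃ c : ℝ, 0 < c ∧ w g ((bBase g).incl (Ψ y)).1 = (c : ℂ) * w g (a : Base g).1)
    (hbelt : ∀ (y : bX.carrier) (j : Fin n) (b : ↥(beltPiece 3 2)), G₀ (bX.incl y) = D.jB j b →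
      G₀ (bX.incl y) ∉ range D.jA →
      ∃ c : ℝ, 0 < c ∧ w g ((bBase g).incl (Ψ y)).1 = (c : ℂ) * d j)
    (hd : ∀ j, ‖d j‖ = 1) {e : ℂ} (he : ‖e‖ = 1) (hej : ∀ j, d j ≠ e) (y : bX.carrier)
    (hy : ∃ c : ℝ, 0 < c ∧ w g ((bBase g).incl (Ψ y)).1 = (c : ℂ) * e) :
    ∃ a : ↥(coresComplement h), G₀ (bX.incl y) = D.jA a ∧
      (∃ c : ℝ, 0 < c ∧ w g (a : Base g).1 = (c : ℂ) * e) ∧ (a : Base g) ∈ (𝓡∂ 4).boundary (Base g) := by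
  obtain ⟨c, hc, hcw⟩ := hy
  -- `y` is not a deep belt point: its direction would be a handle direction
  have hseam_pt : ∃ a : ↥(coresComplement h), G₀ (bX.incl y) = D.jA a := by
    by_contra hno
    push Not at hno
    rcases D.mem_range_or (G₀ (bX.incl y)) with ⟨a, ha⟩ | ⟨j, b, hb⟩
    · exact hno a ha.symm
    · have hnot : G₀ (bX.incl y) ∉ range D.jA := by
        rintro ⟨a, ha⟩; exact hno a ha.symm
      obtain ⟨c', hc', hc'w⟩ := hbelt y j b hb.symm hnot
      have := eq_of_pos_mul_unit_eq hc hc' he (hd j) (hcw.symm.trans hc'w)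
      exact hej j this.symm
  obtain ⟨a, ha⟩ := hseam_pt
  obtain ⟨c'', hc'', hw⟩ := hseam y a ha
  refine ⟨a, ha, ⟨c / c'', div_pos hc hc'', ?_⟩, mem_boundary_of_G₀_incl_eq_jA bX G₀ D ha⟩
  have hne : (c'' : ℂ) ≠ 0 := by exact_mod_cast hc''.ne'
  have e1 : w g (a : Base g).1 = (c'' : ℂ)⁻¹ * w g ((bBase g).incl (Ψ y)).1 := by
    rw [hw, ← mul_assoc, inv_mul_cancel₀ hne, one_mul]
  rw [e1, hcw, ← mul_assoc]
  congr 1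
  push_cast
  field_simp

/-- **Sub-goal `helper_offCritical_seam` of stub `stub_M2geo`** (N1 ▸ `node_N1_move` ▸ (d) N1-mono, brick
H4-1′; wave 7, lead c5).  OFF THE BELT PAGE ANGLE THE PAGES OF `∂X` ARE BASE PAGES: for the telescope of
`node_N1_move` with the seam and belt clauses through `G₀` and a handle `k` whose direction is not shared,
there is `η ∈ (0, π]` such that every `y ∈ ∂X₀` with `w (Ψ y) ∈ ℝ_{>0} · d k · e^{iσ}`, `0 < |σ| < η`, is a
seam point `G₀ (bX.incl y) = D.jA a` with `w a ∈ ℝ_{>0} · d k · e^{iσ}` and `a ∈ ∂ Base g`.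
[cite: Kosinski1993, VI §6] -/
theorem helper_offCritical_seam : ∀ (g n : ℕ) (X₀ : Type) [TopologicalSpace X₀] [ChartedSpace (EuclideanHalfSpace 4) X₀] (bX : Literature.Topology.FourManifolds.BoundaryData (𝓡∂ 4) X₀ (𝓡 3)) (Ψ : bX.carrier → (Literature.Topology.FourManifolds.LefschetzBase.bBase g).carrier) (X : Type) [TopologicalSpace X] [ChartedSpace (EuclideanHalfSpace 4) X] (G₀ : X₀ ≃ₘ⟮𝓡∂ 4, 𝓡∂ 4⟯ X) (h : Fin n → Literature.Topology.FourManifolds.HandleAttachingMap 3 2 (Literature.Topology.FourManifolds.LefschetzBase.Base g)) (D : Literature.Topology.FourManifolds.HandleAttachingMap.MultiAttachmentData h (𝓡∂ 4) X) (d : Fin n → ℂ) (k : Fin n), (∀ j, ‖d j‖ = 1) → (∀ j, j ≠ k → d j ≠ d k) → (∀ (y : bX.carrier) (a : ↥(Literature.Topology.FourManifolds.HandleAttachingMap.coresComplement h)), G₀ (bX.incl y) = D.jA a → ∃ c : ℝ, 0 < c ∧ Literature.Topology.FourManifolds.LefschetzBase.w g ((Literature.Topology.FourManifolds.LefschetzBase.bBase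 g).incl (Ψ y)).1 = (c : ℂ) * Literature.Topology.FourManifolds.LefschetzBase.w g (a : Literature.Topology.FourManifolds.LefschetzBase.Base g).1) → (∀ (y : bX.carrier) (j : Fin n) (b : ↥(Literature.Topology.FourManifolds.beltPiece 3 2)), G₀ (bX.incl y) = D.jB j b → G₀ (bX.incl y) ∉ Set.range D.jA → ∃ c : ℝ, 0 < c ∧ Literature.Topology.FourManifolds.LefschetzBase.w g ((Literature.Topology.FourManifolds.LefschetzBase.bBase g).incl (Ψ y)).1 = (c : ℂ) * d j) → ∃ η : ℝ, 0 < η ∧ η ≤ Real.pi ∧ ∀ (y : bX.carrier) (σ : ℝ), σ ≠ 0 → |σ| < η → (∃ c : ℝ, 0 < c ∧ Literature.Topology.FourManifolds.LefschetzBase.w g ((Literature.Topology.FourManifolds.LefschetzBase.bBase g).incl (Ψ y)).1 = (c : ℂ) * (d k * Complex.exp ((σ : ℂ) * Complex.I))) → ∃ a : ↥(Literature.Topology.FourManifolds.HandleAttachingMap.coresComplement h), G₀ (bX.incl y) = D.jA a ∧ (∃ c : ℝ, 0 < c ∧ Literature.Topology.FourManifolds.LefschetzBase.w g (a : Literature.Topology.FourManifolds.LefschetzBase.Base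 g).1 = (c : ℂ) * (d k * Complex.exp ((σ : ℂ) * Complex.I))) ∧ (a : Literature.Topology.FourManifolds.LefschetzBase.Base g) ∈ (𝓡∂ 4).boundary (Literature.Topology.FourManifolds.LefschetzBase.Base g) := by
  intro g n X₀ _ _ bX Ψ X _ _ G₀ h D d k hd hdk hseam hbelt
  obtain ⟨η, hη, hηπ, hgap⟩ := exists_angle_gap d k hd hdk
  refine ⟨η, hη, hηπ, fun y σ hσ0 hση hy => ?_⟩
  have he : ‖d k * Complex.exp ((σ : ℂ) * Complex.I)‖ = 1 := by
    rw [norm_mul, hd k, Complex.norm_exp_ofReal_mul_I, mul_one]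
  exact seam_of_offCritical bX Ψ G₀ D d hseam hbelt hd he (hgap σ hσ0 hση) y hy

end OffCritical

end Summit.SmoothPoincare4.SmoothPoincare4.Theorems.AcyclicBisectionExists.ModpBraidOrbits

end
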